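import Mathlib
import Literature.NumberTheory.LFunctions.Zhang2022.SkeletonPartTwo
import Literature.NumberTheory.LFunctions.Zhang2022.Section8ChangeOfVariables
import Literature.NumberTheory.LFunctions.Zhang2022.Section8ArithmeticIdentity
import HarnessLib

/-!
# Zhang (2022) §8, typed statements — slice L2-t8: the evaluation of `S_j(𝐚₁₁,𝐚₂₁)`
# (tex L2420–L2478, PDF pp. 47–48): the four applications of Lemmas 8.2/8.4, the "gathering"
# display, the `n = qᵏ` identity, (8.10), the substituted display, `λ₀ⱼ(n) = φ(n)²/n² + O(α₁)`,
# the `[T, 1.2.12]` mean value, (8.11), (8.12)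

Topic `Literature/NumberTheory/LFunctions/Zhang2022` (Landau–Siegel audit tree; verdict-neutral).
Y. Zhang, *Discrete mean estimates and the Landau–Siegel zero*, arXiv:2211.02515v1 (2022)
[Zhang2022LandauSiegel] — **an unrefereed manuscript under adjudication. Every `def … : Prop`
below is a CLAIM OF THE MANUSCRIPT, STATED NOT ASSERTED** (D-0069 statement-typing campaign,
cell `siegel-zhang`, layer L2, slice `L2-t8` of `plan/L2/ASSIGNMENTS.md` v1): the passage of §8
between the proof of Lemma 8.4 and (8.12), i.e. the manuscript's route
"Lemmas 8.2–8.4 ⇒ (8.11) ⇒ (8.12)" for `S_j(𝐚₁₁,𝐚₂₁)`, which the banked skeleton folds into the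
single deduction node `Skeleton.Ded823 c′` (`SkeletonPartTwo`). Typed ≠ discharged.

Node ids are those of the cell's `plan/DAG.tsv` (first token of every docstring); locators are
`[Z22 p.<PDF page>, tex L<line of lsz3__2_.tex>]`, read on the page renders `pages/p0047.txt`,
`pages/p0048.txt` of the cell's source copy. Throughout, `1 ≤ j ≤ 3`, (A) is in force (§5), the
sums `Σ_m`, `Σ_n` are the inner sums of `Skeleton.Sj` (finite: `ϰ₁, ϰ₂` vanish beyond `P₁, P₂`;
written over the range `m, n < ⌈PT⁻²⌉ = Skeleton.Nsupp D` of `Skeleton.Sj`), `𝓕_{jμ}(x)`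
(printed `\mathcal F`) is `Skeleton.frakfW c′ D j μ x` (Lemma 8.2), `𝓖_{jμ}(x)` is
`Skeleton.frakgW c′ D j μ x` (Lemma 8.4), `Π(d,r)` is `Skeleton.PiW χ d r` (Lemma 8.3),
`λ₀ⱼ` is `Skeleton.lamZero c′ D j`, `L′(1,χ)` is `deriv χ.LFunction 1`, `𝔞 = Skeleton.frakA χ` (2.31).

| node | decl | locator | printed claim (abridged) |
|---|---|---|---|
| `Z22:§8.u040` | `Step8u040 c′` | p.47 L2421 | `Σ_m χ(m)ϰ₁(drm)m^{−(1−β_j)} = L′(1,χ)(log P₁)⁻¹𝓕_{j6}(P₁/dr) + O(𝓛⁻¹⁵)`, `dr < P₁/T` |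
| `Z22:§8.u041` | `Step8u041 c′` | p.47 L2425 | same with `ϰ₂, P₂, 𝓕_{j7}`, `dr < P₂/T` |
| `Z22:§8.u042` | `Step8u042 c′` | p.47 L2429 | `Σ_n χ(n)ϰ̄₁(drn)ξ₀ⱼ(n;d,r)n⁻¹ = L′(1,χ)Π(d,r)(log P₁)⁻¹𝓖_{j6}(P₁/dr) + O(𝓛⁻¹⁵)` |
| `Z22:§8.u043` | `Step8u043 c′` | p.47 L2433 | same with `ϰ̄₂, P₂, 𝓖_{j7}` |
| `Z22:§8.u044` | `Step8u044 c′` | p.47 L2437 | the "gathering" display for `S_j(𝐚₁₁,𝐚₂₁)` (`Σ_{dr<P₂}` + `Σ_{P₂≤dr<P₁}`, `+o(α)`) |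
| `Z22:§8.u045` | `Step8u045` | p.47 L2444 | `Σ_{n=dr}|μ(r)|r⁻¹∏_{(q,r)=1,q∣d}(1−q⁻¹−χ(q)q⁻¹) = ∏_{q∣n}(1−χ(q)q⁻¹)` (PROVED in tree, real weights: `sum_squarefree_divisors_local`) |
| `Z22:(8.10)` | `Eq810` | p.48 L2448 | `Σ_{n=dr}|μ(r)|φ(r)⁻¹Π(d,r) = n/φ(n)` (PROVED in tree, real weights: `sum_squarefree_divisors_PiLocal`) |
| `Z22:§8.u046` | `Step8u046 c′` | p.48 L2452 | the display after "substituting `n = dr`" (`Σ_{n<P₂}` + `Σ_{P₂≤n<P₁}`, `+o(α)`) |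
| `Z22:§8.u047` | `Step8u047local c′`, `Step8u047 c′` | p.48 L2459 | `λ₀ⱼ(n) = ∏_{q∣n}(1−q⁻¹)²(1+O(α log q/q)) = φ(n)²/n² + O(α₁)`, `n < P` |
| `Z22:§8.u048` | `Step8u048`, `Step8u048const` | p.48 L2463 | `Σ_{n<x}|χ(n)|φ(n)n⁻² = (φ(D)/D)∏_{(q,D)=1}(1−q⁻²)log x + O(log 𝓛) = (6/π²)∏_{q∣D}q/(q+1)·log x + O(log 𝓛)`, `x < P`, "[T, 1.2.12]" |
| `Z22:(8.11)` | `Eq811 c′` | p.48 L2467 | `S_j(𝐚₁₁,𝐚₂₁) = 𝔞∫₁^{P₂}(…)(…)dx/x + 𝔞(log P₁)⁻²∫_{P₂}^{P₁}𝓕_{j6}𝓖_{j6}(P₁/x)dx/x + o(α)` (right side = `𝔞·S811`, `Section8ChangeOfVariables`) |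
| `Z22:(8.12)` | `Eq812 c′` | p.48 L2473 | the four-term form after `x → P₁/x`, `x → P₂/x` (right side = `𝔞·S812`) |

and the manuscript's inferences between them as named implications (refining `Skeleton.Ded823 c′`):
`DedStep8u044` ("Gathering these results together … by simple approximation"), `DedStep8u046`
("substituting `n = dr`" via (8.10)), `Ded811` ("it follows by partial integration"), `Ded812`
("by the change of variable") — the last one is PROVED here (`ded812_holds`, from the tree's
`S811_eq_S812`). Objects (`def`, lowerCamel): `mFac`, `nFac`, `diagFac` (the three `x`-profiles of
(8.11)), `arithW` (the arithmetic weight of the gathering display), `theta2` (the exponent with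
`P^{θ₂} = P₂`; `Ppow_theta1`, `Ppow_theta2` certify that the `S811`/`S812` parametrisation
`(Λ, θ₁, θ₂) = (𝓛⁹, 0.504, θ₂)` has `P^{θ₁} = P₁`, `P^{θ₂} = P₂` exactly).

Recorded readings (no verdicts): (i) tex L2428 says "by Lemma 8.3 with `x = P₁/dr` …" where the
displayed conclusions are those of Lemma 8.4 (Lemma 8.3 supplies `Π(d,r)`); typed as printed
(the displays), the attribution noted. (ii) The four applications print `O(𝓛⁻¹⁵)` while Lemmas
8.2/8.4 print `O(𝓛⁻⁶)`: consistent, since the displays carry the extra factor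
`(log P_k)⁻¹ = O(𝓛⁻⁹)` (`log P₁ = 0.504𝓛⁹`); typed as printed, `𝓛⁻¹⁵`. (iii) `α₁` in
`Z22:§8.u047` is UNDEFINED in the manuscript (cell record read1-12; skeleton convention
`O(α₁) ↦ ≤ C·α𝓛`, skel/GAP-NODE-MAP.md): `Step8u047` is typed with `α𝓛`; the alternative reading
`α₁ = α log T = α𝓛^{1.1}` of the tree's `PartIIConstraints`/`PartIIIAppendixBRows` is weaker —
AMBIGUITY recorded in the docstring. (iv) "for `x < P`" in `Z22:§8.u048` is typed on the sum's
natural range `1 ≤ x < P`. (v) "[T, 1.2.12]" = Titchmarsh–Heath-Brown (1986) (1.2.12)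
`ζ(s−1)/ζ(s) = Σφ(n)n^{−s}` (the manuscript's [19]; held, book p. 9): the generating function only —
the twisted logarithmic mean value is the manuscript's claim (cell FACT-CANDIDATE, not a Literature
fact; no new named fact is introduced here).

WHAT THIS IS NOT: any claim about Theorems 1–2 of the manuscript or about Landau–Siegel zeros;
a discharge of any node (every `Prop` here is stated, not asserted; the one theorem `ded812_holds`
is the elementary change of variables already kernel-checked in `Section8ChangeOfVariables`).

## References

* Y. Zhang, arXiv:2211.02515v1 (2022), §8 pp. 47–48 (tex L2420–L2478), Lemmas 8.2–8.4, (8.10)–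
  (8.12); (2.21), (2.31). [cite: Zhang2022LandauSiegel, §8 pp.47–48]
* E. C. Titchmarsh, *The Theory of the Riemann Zeta-Function*, 2nd ed. revised by
  D. R. Heath-Brown (1986), (1.2.12) — the manuscript's reference [T] = [19].
-/

noncomputable section

open Complex Real ComplexConjugate Set

namespace Literature.NumberTheory.LFunctions.Zhang2022.Section8cStatements

open Literature.NumberTheory.LFunctions.Zhang2022.Skeleton

variable (c' : ℝ)

/-! ## The four applications of Lemmas 8.2 and 8.4 (p. 47) -/

/-- `Z22:§8.u040` CLAIM. "By Lemma 8.2 with `x = P₁/dr` … we have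
`Σ_m χ(m)ϰ₁(drm)/m^{1−β_j} = (L′(1,χ)/log P₁) 𝓕_{j6}(P₁/dr) + O(𝓛⁻¹⁵)` if `dr < P₁/T`"
(`ϰ₁` of (8.6) = `Skeleton.vk1`; the sum over all `m` is written over `1 ≤ m < ⌈PT⁻²⌉`, the range of
`Skeleton.Sj`, which contains its support `drm < P₁`; `O(𝓛⁻¹⁵)` as printed — Lemma 8.2's `O(𝓛⁻⁶)`
divided by `log P₁ = 0.504𝓛⁹`). Under (A), for all large `D`, `1 ≤ j ≤ 3`.
[cite: Zhang2022LandauSiegel, §8 step after Lemma 8.4 p.47, tex L2421] -/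
def Step8u040 : Prop :=
  ∃ C : ℝ, ForAllLarge fun D _ χ => AssumptionA D χ →
    ∀ j ∈ ({1, 2, 3} : Finset ℕ), ∀ d r : ℕ, 1 ≤ d → 1 ≤ r →
      ((d * r : ℕ) : ℝ) < Skeleton.P1 D / bigT D →
        ‖(∑ m ∈ Finset.Ico 1 (Nsupp D),
              χ (m : ZMod D) * vk1 D (d * r * m) / (m : ℂ) ^ (1 - betaJ c' D j)) -
            deriv χ.LFunction 1 / (Real.log (Skeleton.P1 D) : ℂ) *
              frakfW c' D j 6 (Skeleton.P1 D / ((d * r : ℕ) : ℝ))‖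
          ≤ C * (ell D ^ 15)⁻¹

/-- `Z22:§8.u041` CLAIM. "… and `x = P₂/dr` respectively":
`Σ_m χ(m)ϰ₂(drm)/m^{1−β_j} = (L′(1,χ)/log P₂) 𝓕_{j7}(P₂/dr) + O(𝓛⁻¹⁵)` if `dr < P₂/T`"
(`ϰ₂` of (8.6) = `Skeleton.vk2`, `P₂ = P^{0.5}T^{−10}` (2.21); conventions as in `Step8u040`).
[cite: Zhang2022LandauSiegel, §8 step after Lemma 8.4 p.47, tex L2425] -/
def Step8u041 : Prop :=
  ∃ C : ℝ, ForAllLarge fun D _ χ => AssumptionA D χ →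
    ∀ j ∈ ({1, 2, 3} : Finset ℕ), ∀ d r : ℕ, 1 ≤ d → 1 ≤ r →
      ((d * r : ℕ) : ℝ) < Skeleton.P2 D / bigT D →
        ‖(∑ m ∈ Finset.Ico 1 (Nsupp D),
              χ (m : ZMod D) * vk2 D (d * r * m) / (m : ℂ) ^ (1 - betaJ c' D j)) -
            deriv χ.LFunction 1 / (Real.log (Skeleton.P2 D) : ℂ) *
              frakfW c' D j 7 (Skeleton.P2 D / ((d * r : ℕ) : ℝ))‖
          ≤ C * (ell D ^ 15)⁻¹

/-- `Z22:§8.u042` CLAIM. "On the other hand, by Lemma 8.3 [sic: the display is Lemma 8.4's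
conclusion at `x = P₁/dr`, `μ = 6`; Lemma 8.3 supplies `Π(d,r)`] with `x = P₁/dr` … we have
`Σ_n χ(n)ϰ̄₁(drn)ξ₀ⱼ(n;d,r)/n = (L′(1,χ)Π(d,r)/log P₁) 𝓖_{j6}(P₁/dr) + O(𝓛⁻¹⁵)` if `dr < P₁/T`"
(`ϰ̄₁` = complex conjugate of `Skeleton.vk1`, as in `𝐚₂₁ = conj 𝐚₁₁` (8.8); `ξ₀ⱼ = Skeleton.xiZero`;
the sum over all `n` written over `1 ≤ n < ⌈PT⁻²⌉`; Lemma 8.4's hypothesis `dr < PT⁻²` is implied by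
`dr < P₁/T` for large `D`). Under (A), for all large `D`, `1 ≤ j ≤ 3`.
[cite: Zhang2022LandauSiegel, §8 step after Lemma 8.4 p.47, tex L2429] -/
def Step8u042 : Prop :=
  ∃ C : ℝ, ForAllLarge fun D _ χ => AssumptionA D χ →
    ∀ j ∈ ({1, 2, 3} : Finset ℕ), ∀ d r : ℕ, 1 ≤ d → 1 ≤ r →
      ((d * r : ℕ) : ℝ) < Skeleton.P1 D / bigT D →
        ‖(∑ n ∈ Finset.Ico 1 (Nsupp D),
              χ (n : ZMod D) * conj (vk1 D (d * r * n)) * xiZero c' D j n d r / (n : ℂ)) -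
            deriv χ.LFunction 1 * PiW χ d r / (Real.log (Skeleton.P1 D) : ℂ) *
              frakgW c' D j 6 (Skeleton.P1 D / ((d * r : ℕ) : ℝ))‖
          ≤ C * (ell D ^ 15)⁻¹

/-- `Z22:§8.u043` CLAIM. "… and `x = P₂/dr` respectively":
`Σ_n χ(n)ϰ̄₂(drn)ξ₀ⱼ(n;d,r)/n = (L′(1,χ)Π(d,r)/log P₂) 𝓖_{j7}(P₂/dr) + O(𝓛⁻¹⁵)` if `dr < P₂/T`"
(conventions as in `Step8u042`). [cite: Zhang2022LandauSiegel, §8 step after Lemma 8.4 p.47, tex L2433] -/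
def Step8u043 : Prop :=
  ∃ C : ℝ, ForAllLarge fun D _ χ => AssumptionA D χ →
    ∀ j ∈ ({1, 2, 3} : Finset ℕ), ∀ d r : ℕ, 1 ≤ d → 1 ≤ r →
      ((d * r : ℕ) : ℝ) < Skeleton.P2 D / bigT D →
        ‖(∑ n ∈ Finset.Ico 1 (Nsupp D),
              χ (n : ZMod D) * conj (vk2 D (d * r * n)) * xiZero c' D j n d r / (n : ℂ)) -
            deriv χ.LFunction 1 * PiW χ d r / (Real.log (Skeleton.P2 D) : ℂ) *
              frakgW c' D j 7 (Skeleton.P2 D / ((d * r : ℕ) : ℝ))‖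
          ≤ C * (ell D ^ 15)⁻¹

/-! ## The "gathering" display (p. 47), (8.10), and the substitution `n = dr` (p. 48) -/

/-- `Z22:§8.u044`/`Z22:(8.11)` OBJECT: the `m`-factor `𝓕_{j6}(P₁/u)/log P₁ + ι₂𝓕_{j7}(P₂/u)/log P₂`
of the gathering display (`u = dr`), of the substituted display (`u = n`) and of (8.11) (`u = x`)
(`ι₂` of (2.26) = `iota2`). [cite: Zhang2022LandauSiegel, §8 (8.11) p.48, tex L2467] -/
def mFac (D : ℕ) (j : ℕ) (u : ℝ) : ℂ :=
  frakfW c' D j 6 (Skeleton.P1 D / u) / (Real.log (Skeleton.P1 D) : ℂ) +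
    iota2 * frakfW c' D j 7 (Skeleton.P2 D / u) / (Real.log (Skeleton.P2 D) : ℂ)

/-- `Z22:§8.u044`/`Z22:(8.11)` OBJECT: the `n`-factor `𝓖_{j6}(P₁/u)/log P₁ + ῑ₂𝓖_{j7}(P₂/u)/log P₂`
of the gathering display, the substituted display and (8.11).
[cite: Zhang2022LandauSiegel, §8 (8.11) p.48, tex L2467] -/
def nFac (D : ℕ) (j : ℕ) (u : ℝ) : ℂ :=
  frakgW c' D j 6 (Skeleton.P1 D / u) / (Real.log (Skeleton.P1 D) : ℂ) +
    conj iota2 * frakgW c' D j 7 (Skeleton.P2 D / u) / (Real.log (Skeleton.P2 D) : ℂ)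

/-- `Z22:§8.u044`/`Z22:(8.11)` OBJECT: the diagonal profile `𝓕_{j6}(P₁/u)𝓖_{j6}(P₁/u)/(log P₁)²`
of the range `P₂ ≤ u < P₁`. [cite: Zhang2022LandauSiegel, §8 (8.11) p.48, tex L2467] -/
def diagFac (D : ℕ) (j : ℕ) (u : ℝ) : ℂ :=
  frakfW c' D j 6 (Skeleton.P1 D / u) * frakgW c' D j 6 (Skeleton.P1 D / u) / (Real.log (Skeleton.P1 D) : ℂ) ^ 2

/-- `Z22:§8.u044` OBJECT: the arithmetic weight `|μ(r)χ(dr)| λ₀ⱼ(dr)Π(d,r)/(drφ(r))` of the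
gathering display (`|μ(r)|` = `1` for squarefree `r`, else `0`; `|χ(dr)|` as the norm of `χ(dr)`).
[cite: Zhang2022LandauSiegel, §8 display before (8.10) p.47, tex L2437] -/
def arithW {D : ℕ} [NeZero D] (χ : DirichletCharacter ℂ D) (j d r : ℕ) : ℂ :=
  ((ArithmeticFunction.moebius r).natAbs : ℂ) * (‖χ ((d * r : ℕ) : ZMod D)‖ : ℂ) /
      (((d * r : ℕ) : ℂ) * (Nat.totient r : ℂ)) *
    lamZero c' D j (d * r) * PiW χ d r

/-- `Z22:§8.u044` CLAIM. "Gathering these results together we conclude, by simple approximation, that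
`S_j(𝐚₁₁,𝐚₂₁) = L′(1,χ)² Σ_{dr<P₂} |μ(r)χ(dr)|/(drφ(r)) λ₀ⱼ(dr)Π(d,r)
  × (𝓕_{j6}(P₁/dr)/log P₁ + ι₂𝓕_{j7}(P₂/dr)/log P₂)(𝓖_{j6}(P₁/dr)/log P₁ + ῑ₂𝓖_{j7}(P₂/dr)/log P₂)
  + L′(1,χ)² Σ_{P₂≤dr<P₁} |μ(r)χ(dr)|/(drφ(r)) λ₀ⱼ(dr)Π(d,r) 𝓕_{j6}(P₁/dr)𝓖_{j6}(P₁/dr)/(log P₁)²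
  + o(α)`" (`S_j(𝐚₁₁,𝐚₂₁) = Skeleton.Sj c′ D j (a11 χ) (a21 χ)`, Prop. 7.1 with (8.8); the sums over
pairs `(d,r)`, `d, r ≥ 1`, are grouped by `n = dr` via `Nat.divisorsAntidiagonal`; "`+ o(α)`" typed as
`≤ εα` for every `ε > 0`, eventually). Under (A). [cite: Zhang2022LandauSiegel, §8 display before (8.10) p.47, tex L2437] -/
def Step8u044 : Prop :=
  ∀ ε : ℝ, 0 < ε → ForAllLarge fun D _ χ => AssumptionA D χ →
    ∀ j ∈ ({1, 2, 3} : Finset ℕ),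
      ‖Sj c' D j (a11 χ) (a21 χ) -
          (deriv χ.LFunction 1 ^ 2 *
              (∑ n ∈ Finset.Ico 1 ⌈Skeleton.P2 D⌉₊, ∑ p ∈ Nat.divisorsAntidiagonal n,
                arithW c' χ j p.1 p.2 * (mFac c' D j n * nFac c' D j n)) +
            deriv χ.LFunction 1 ^ 2 *
              (∑ n ∈ Finset.Ico ⌈Skeleton.P2 D⌉₊ ⌈Skeleton.P1 D⌉₊, ∑ p ∈ Nat.divisorsAntidiagonal n,
                arithW c' χ j p.1 p.2 * diagFac c' D j n))‖
        ≤ ε * alpha D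

/-- `Z22:§8.u045` CLAIM. "It can be shown, by verifying the case `n = qᵏ`, that
`Σ_{n=dr} |μ(r)| r⁻¹ ∏_{(q,r)=1, q∣d} (1 − q⁻¹ − χ(q)q⁻¹) = ∏_{q∣n} (1 − χ(q)q⁻¹)`"
(sum over the factorisations `n = dr` with `r` squarefree, `d = n/r`; products over primes `q`).
PROVED in the tree for an arbitrary real weight `c(q)` in place of `χ(q)` (the values of the real
character `χ`): `Zhang2022.sum_squarefree_divisors_local` (`Section8ArithmeticIdentity`); stated here,
as printed, for the real (quadratic) character `χ` of the manuscript, with its values in `ℂ`.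
[cite: Zhang2022LandauSiegel, §8 display before (8.10) p.47, tex L2444] -/
def Step8u045 : Prop :=
  ∀ (D : ℕ) [NeZero D] (χ : DirichletCharacter ℂ D), χ.IsQuadratic → ∀ n : ℕ, n ≠ 0 →
    ∑ r ∈ n.divisors with Squarefree r,
        (1 / (r : ℂ)) * ∏ q ∈ (n / r).primeFactors with Nat.Coprime q r,
          (1 - (q : ℂ)⁻¹ - χ (q : ZMod D) * (q : ℂ)⁻¹)
      = ∏ q ∈ n.primeFactors, (1 - χ (q : ZMod D) * (q : ℂ)⁻¹)

/-- `Z22:(8.10)` CLAIM. "so that `Σ_{n=dr} |μ(r)| φ(r)⁻¹ Π(d,r) = n/φ(n)`" (`Π(d,r)` of Lemma 8.3 =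
`Skeleton.PiW χ d r`; sum over `n = dr`, `r` squarefree). PROVED in the tree for real weights:
`Zhang2022.sum_squarefree_divisors_PiLocal` with `Zhang2022.PiLocal` (`Section8ArithmeticIdentity`,
hypothesis `c(q) ≠ q`, automatic for `|χ(q)| ≤ 1`); stated here with the skeleton's complex `Π(d,r)`,
for the real (quadratic) character `χ` of the manuscript. [cite: Zhang2022LandauSiegel, §8 (8.10) p.48, tex L2448] -/
def Eq810 : Prop :=
  ∀ (D : ℕ) [NeZero D] (χ : DirichletCharacter ℂ D), χ.IsQuadratic → ∀ n : ℕ, n ≠ 0 →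
    ∑ r ∈ n.divisors with Squarefree r, (1 / (Nat.totient r : ℂ)) * PiW χ (n / r) r
      = (n : ℂ) / (Nat.totient n : ℂ)

/-- `Z22:§8.u046` CLAIM. "It follows, by substituting `n = dr`, that
`S_j(𝐚₁₁,𝐚₂₁) = L′(1,χ)² Σ_{n<P₂} |χ(n)|λ₀ⱼ(n)/φ(n)
  × (𝓕_{j6}(P₁/n)/log P₁ + ι₂𝓕_{j7}(P₂/n)/log P₂)(𝓖_{j6}(P₁/n)/log P₁ + ῑ₂𝓖_{j7}(P₂/n)/log P₂)
  + L′(1,χ)² Σ_{P₂≤n<P₁} |χ(n)|λ₀ⱼ(n)/φ(n) 𝓕_{j6}(P₁/n)𝓖_{j6}(P₁/n)/(log P₁)² + o(α)`"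
(`λ₀ⱼ(n) = Skeleton.lamZero c′ D j n`; sums over `1 ≤ n < P₂` and `P₂ ≤ n < P₁`). Under (A).
[cite: Zhang2022LandauSiegel, §8 display after (8.10) p.48, tex L2452] -/
def Step8u046 : Prop :=
  ∀ ε : ℝ, 0 < ε → ForAllLarge fun D _ χ => AssumptionA D χ →
    ∀ j ∈ ({1, 2, 3} : Finset ℕ),
      ‖Sj c' D j (a11 χ) (a21 χ) -
          (deriv χ.LFunction 1 ^ 2 *
              (∑ n ∈ Finset.Ico 1 ⌈Skeleton.P2 D⌉₊,
                (‖χ (n : ZMod D)‖ : ℂ) * lamZero c' D j n / (Nat.totient n : ℂ) *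
                  (mFac c' D j n * nFac c' D j n)) +
            deriv χ.LFunction 1 ^ 2 *
              (∑ n ∈ Finset.Ico ⌈Skeleton.P2 D⌉₊ ⌈Skeleton.P1 D⌉₊,
                (‖χ (n : ZMod D)‖ : ℂ) * lamZero c' D j n / (Nat.totient n : ℂ) * diagFac c' D j n))‖
        ≤ ε * alpha D

/-! ## `λ₀ⱼ(n)` and the `[T, 1.2.12]` mean value (p. 48) -/

/-- `Z22:§8.u047` CLAIM, first equality (the local factors). "Since for `n < P`,
`λ₀ⱼ(n) = ∏_{q∣n} (1 − q⁻¹)² (1 + O(α log q/q))`" — i.e. for every prime `q < P` the local factor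
`λ₀ⱼ(q) = λ(q, 1 − β_j)` (§7; `λ₀ⱼ(n) = ∏_{q∣n} λ₀ⱼ(q)` by the definition of `Skeleton.lam` as a
product over the prime factors) is `(1 − q⁻¹)²(1 + O(α log q/q))`, uniformly (`1 ≤ j ≤ 3`; no (A)
needed, `D` large). [cite: Zhang2022LandauSiegel, §8 display before (8.11) p.48, tex L2459] -/
def Step8u047local : Prop :=
  ∃ C : ℝ, ForAllLarge fun D _ _ =>
    ∀ j ∈ ({1, 2, 3} : Finset ℕ), ∀ q : ℕ, q.Prime → (q : ℝ) < bigP D →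
      ‖lamZero c' D j q - (1 - (q : ℂ)⁻¹) ^ 2‖ ≤
        C * (1 - (q : ℝ)⁻¹) ^ 2 * (alpha D * Real.log q / q)

/-- `Z22:§8.u047` CLAIM, second equality. "… `= φ(n)²/n² + O(α₁)`" for `n < P`.
AMBIGUITY: `α₁` is nowhere defined in the manuscript (cell record read1-12). Typed with the
skeleton's convention `O(α₁) ↦ ≤ C·α𝓛` (skel/GAP-NODE-MAP.md; `α𝓛 = π𝓛⁻⁸`); the alternative cell
reading `α₁ := α log T = α𝓛^{1.1}` (`Zhang2022.PartIIConstraints`) is the weaker statement with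
`ell D ^ (1.1 : ℝ)` in place of `ell D`. (`1 ≤ j ≤ 3`; `D` large; no (A) needed.)
[cite: Zhang2022LandauSiegel, §8 display before (8.11) p.48, tex L2459] -/
def Step8u047 : Prop :=
  ∃ C : ℝ, ForAllLarge fun D _ _ =>
    ∀ j ∈ ({1, 2, 3} : Finset ℕ), ∀ n : ℕ, 1 ≤ n → (n : ℝ) < bigP D →
      ‖lamZero c' D j n - ((Nat.totient n : ℂ) / (n : ℂ)) ^ 2‖ ≤ C * (alpha D * ell D)

/-- `Z22:§8.u048` CLAIM (the mean value). "and, for `x < P`,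
`Σ_{n<x} |χ(n)|φ(n)/n² = (φ(D)/D)(∏_{(q,D)=1}(1 − q⁻²)) log x + O(log 𝓛)
  = (6/π²)(∏_{q∣D} q/(q+1)) log x + O(log 𝓛)`, (see [T, 1.2.12])" — typed with the second (closed)
constant, the one that produces `𝔞` of (2.31) in (8.11); the equality of the two constants is
`Step8u048const`. `|χ(n)| = 1` if `(n,D) = 1`, else `0` (norm of `χ(n)`). Range typed as `1 ≤ x < P`
(the printed "for `x < P`"; the sum is over `1 ≤ n < x`). [T, 1.2.12] = Titchmarsh–Heath-Brown (1986)
(1.2.12), `ζ(s−1)/ζ(s) = Σ φ(n)n^{−s}` — the generating function; the mean value is the manuscript's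
claim (cell FACT-CANDIDATE `Z22:§8.u047/u048`; no Literature fact is introduced). `D` large; no (A)
needed. [cite: Zhang2022LandauSiegel, §8 display before (8.11) p.48, tex L2463] -/
def Step8u048 : Prop :=
  ∃ C : ℝ, ForAllLarge fun D _ χ =>
    ∀ x : ℝ, 1 ≤ x → x < bigP D →
      |(∑ n ∈ Finset.Ico 1 ⌈x⌉₊, ‖χ (n : ZMod D)‖ * (Nat.totient n : ℝ) / (n : ℝ) ^ 2) -
          6 / π ^ 2 * (∏ q ∈ D.primeFactors, (q : ℝ) / (q + 1)) * Real.log x|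
        ≤ C * Real.log (ell D)

/-- `Z22:§8.u048` CLAIM (the constant). "`(φ(D)/D) ∏_{(q,D)=1} (1 − q⁻²) = (6/π²) ∏_{q∣D} q/(q+1)`"
(the two main-term constants of the display are equal; the product over the primes `q` coprime to
`D` is an absolutely convergent infinite product, written as a `tprod` over `Nat.Primes` with the
factors at `q ∣ D` set to `1`; `D ≥ 1`). [cite: Zhang2022LandauSiegel, §8 display before (8.11) p.48, tex L2463] -/
def Step8u048const : Prop :=
  ∀ D : ℕ, D ≠ 0 →
    (Nat.totient D : ℝ) / D *
        (∏' p : Nat.Primes, if (p : ℕ) ∣ D then (1 : ℝ) else 1 - ((p : ℝ) ^ 2)⁻¹)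
      = 6 / π ^ 2 * ∏ q ∈ D.primeFactors, (q : ℝ) / (q + 1)

/-! ## (8.11) and (8.12) -/

/-- `Z22:(8.11)` OBJECT: the exponent `θ₂` with `P^{θ₂} = P₂ = P^{0.5}T^{−10}` exactly, i.e.
`θ₂ = 0.5 − 10 log T/log P = 0.5 − 10𝓛^{1.1}/𝓛⁹` ((2.21), `T = exp 𝓛^{1.1}` §6, `P = exp 𝓛⁹` (2.6)),
so that the tree's (8.11)/(8.12) functionals `Zhang2022.S811`, `Zhang2022.S812`
(`Section8ChangeOfVariables`, parametrised by `Λ = log P`, `P₁ = P^{θ₁}`, `P₂ = P^{θ₂}`) are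
evaluated at the manuscript's `P₁, P₂` (`Ppow_theta1`, `Ppow_theta2`).
[cite: Zhang2022LandauSiegel, §2 (2.21) p.10, tex L576] -/
def theta2 (D : ℕ) : ℝ := 0.5 - 10 * ell D ^ (1.1 : ℝ) / ell D ^ 9

/-- `P^{0.504} = P₁` in the `Ppow` parametrisation: `Ppow (𝓛⁹) 0.504 = Skeleton.P1 D`.
[cite: Zhang2022LandauSiegel, §2 (2.21) p.10, tex L576] -/
theorem Ppow_theta1 (D : ℕ) : Ppow (ell D ^ 9) 0.504 = Skeleton.P1 D := by
  rw [Ppow, Skeleton.P1, bigP, Real.exp_mul]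

/-- `P^{θ₂} = P₂` in the `Ppow` parametrisation: `Ppow (𝓛⁹) θ₂ = Skeleton.P2 D` (for `𝓛 ≠ 0`,
i.e. `D ≥ 2`). [cite: Zhang2022LandauSiegel, §2 (2.21) p.10, tex L576] -/
theorem Ppow_theta2 (D : ℕ) (hD : ell D ≠ 0) : Ppow (ell D ^ 9) (theta2 D) = Skeleton.P2 D := by
  have h9 : ell D ^ 9 ≠ 0 := pow_ne_zero _ hD
  rw [Ppow, Skeleton.P2, bigP, bigT, theta2, ← Real.exp_mul, ← Real.exp_nat_mul, ← Real.exp_sub]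
  congr 1
  field_simp
  push_cast
  ring

/-- `Z22:(8.11)` CLAIM. "it follows by partial integration that
`S_j(𝐚₁₁,𝐚₂₁) = 𝔞∫₁^{P₂} (𝓕_{j6}(P₁/x)/log P₁ + ι₂𝓕_{j7}(P₂/x)/log P₂)(𝓖_{j6}(P₁/x)/log P₁ + ῑ₂𝓖_{j7}(P₂/x)/log P₂) dx/x
  + (𝔞/(log P₁)²)∫_{P₂}^{P₁} 𝓕_{j6}(P₁/x)𝓖_{j6}(P₁/x) dx/x + o(α)`  (8.11)"
— the right side without `𝔞` and `o(α)` is, verbatim, the tree's functional `Zhang2022.S811` at the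
profiles `𝓕_{j6}, 𝓕_{j7}, 𝓖_{j6}, 𝓖_{j7}` = `Skeleton.frakfW/frakgW c′ D j 6/7` and the scales
`(Λ, θ₁, θ₂) = (𝓛⁹, 0.504, theta2 D)` (`P^{θ₁} = P₁`, `P^{θ₂} = P₂`: `Ppow_theta1/2`); `𝔞 = Skeleton.frakA χ`
(2.31); "`+ o(α)`" as `≤ εα`. Under (A), `1 ≤ j ≤ 3`. [cite: Zhang2022LandauSiegel, §8 (8.11) p.48, tex L2467] -/
def Eq811 : Prop :=
  ∀ ε : ℝ, 0 < ε → ForAllLarge fun D _ χ => AssumptionA D χ →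
    ∀ j ∈ ({1, 2, 3} : Finset ℕ),
      ‖Sj c' D j (a11 χ) (a21 χ) -
          (frakA χ : ℂ) * S811 (frakfW c' D j 6) (frakfW c' D j 7) (frakgW c' D j 6) (frakgW c' D j 7)
            (ell D ^ 9) 0.504 (theta2 D)‖
        ≤ ε * alpha D

/-- `Z22:(8.12)` CLAIM. "This yields, by the change of variable `x → P₁/x` or `x → P₂/x`,
`S_j(𝐚₁₁,𝐚₂₁) = (𝔞/(log P₁)²)∫₁^{P₁} 𝓕_{j6}(x)𝓖_{j6}(x) dx/x + (𝔞|ι₂|²/(log P₂)²)∫₁^{P₂} 𝓕_{j7}(x)𝓖_{j7}(x) dx/x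
  + (𝔞ι₂/((log P₁)(log P₂)))∫₁^{P₂} 𝓕_{j7}(x)𝓖_{j6}(P^{0.004}T^{10}x) dx/x
  + (𝔞ῑ₂/((log P₁)(log P₂)))∫₁^{P₂} 𝓕_{j6}(P^{0.004}T^{10}x)𝓖_{j7}(x) dx/x + o(α)`  (8.12),
since `P₁/P₂ = P^{0.004}T^{10}`" — right side without `𝔞`, `o(α)` = the tree's `Zhang2022.S812` at the
same arguments as in `Eq811` (it writes the scaling factor as `P₁/P₂`). Under (A), `1 ≤ j ≤ 3`.
[cite: Zhang2022LandauSiegel, §8 (8.12) p.48, tex L2473] -/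
def Eq812 : Prop :=
  ∀ ε : ℝ, 0 < ε → ForAllLarge fun D _ χ => AssumptionA D χ →
    ∀ j ∈ ({1, 2, 3} : Finset ℕ),
      ‖Sj c' D j (a11 χ) (a21 χ) -
          (frakA χ : ℂ) * S812 (frakfW c' D j 6) (frakfW c' D j 7) (frakgW c' D j 6) (frakgW c' D j 7)
            (ell D ^ 9) 0.504 (theta2 D)‖
        ≤ ε * alpha D

/-! ## The manuscript's inferences of this passage, as named implications (refining `Skeleton.Ded823 c′`) -/

/-- `Z22:§8.u044` DEDUCTION (refines `Skeleton.Ded823 c′`, step "Lemmas 8.2–8.4 at `x = P_k/dr`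
⇒ gathering display"): "Gathering these results together we conclude, by simple approximation, that …"
— the four applications imply the gathering display. CLAIM (an implication between claims; the
"simple approximation" covers the ranges `P_k/T ≤ dr < P_k` where the lemmas do not apply).
[cite: Zhang2022LandauSiegel, §8 display before (8.10) p.47, tex L2436] -/
def DedStep8u044 : Prop :=
  Step8u040 c' → Step8u041 c' → Step8u042 c' → Step8u043 c' → Step8u044 c'

/-- `Z22:§8.u046` DEDUCTION (refines `Skeleton.Ded823 c′`): "It follows, by substituting `n = dr`,
that …" — the gathering display and (8.10) imply the substituted display. CLAIM.
[cite: Zhang2022LandauSiegel, §8 display after (8.10) p.48, tex L2451] -/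
def DedStep8u046 : Prop := Step8u044 c' → Eq810 → Step8u046 c'

/-- `Z22:(8.11)` DEDUCTION (refines `Skeleton.Ded823 c′`): "Since … `λ₀ⱼ(n) = φ(n)²/n² + O(α₁)` and
… `Σ_{n<x}|χ(n)|φ(n)/n² = (6/π²)(∏_{q∣D} q/(q+1)) log x + O(log 𝓛)` …, it follows by partial
integration that (8.11)" — the substituted display and the two estimates imply (8.11). CLAIM.
[cite: Zhang2022LandauSiegel, §8 (8.11) p.48, tex L2466] -/
def Ded811 : Prop := Step8u046 c' → Step8u047 c' → Step8u048 → Eq811 c'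

/-- `Z22:(8.12)` DEDUCTION (refines `Skeleton.Ded823 c′`): "This yields, by the change of variable
`x → P₁/x` or `x → P₂/x`, (8.12)" — (8.11) implies (8.12). CLAIM; PROVED below (`ded812_holds`).
[cite: Zhang2022LandauSiegel, §8 (8.12) p.48, tex L2472] -/
def Ded812 : Prop := Eq811 c' → Eq812 c'

/-- `𝓕_{jμ}` (`Skeleton.frakfW`) is continuous on `(0, ∞)` (it is `frakf β_j β_μ (log x)`).
[cite: Zhang2022LandauSiegel, §8 Lemma 8.2 p.45, tex L2345] -/
theorem continuousOn_frakfW (D : ℕ) (j μ : ℕ) : ContinuousOn (frakfW c' D j μ) (Ioi 0) := by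
  have h := continuousOn_ofReal_log
  change ContinuousOn (fun y : ℝ => frakf (betaJ c' D j) (betaMu D μ) (Real.log y)) (Ioi 0)
  unfold frakf
  exact (continuousOn_const.add (continuousOn_const.mul h)).mul (continuousOn_const.mul h).cexp

/-- `𝓖_{jμ}` (`Skeleton.frakgW`) is continuous on `(0, ∞)`.
[cite: Zhang2022LandauSiegel, §8 Lemma 8.4 p.46, tex L2398] -/
theorem continuousOn_frakgW (D : ℕ) (j μ : ℕ) : ContinuousOn (frakgW c' D j μ) (Ioi 0) := by
  have h := continuousOn_ofReal_log
  change ContinuousOn (fun y : ℝ =>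
    frakg (betaJ c' D (j + 1)) (betaJ c' D (j + 2)) (betaMu D μ) (Real.log y)) (Ioi 0)
  unfold frakg
  exact continuousOn_const.add
    ((continuousOn_const.sub (continuousOn_const.mul h)).mul (continuousOn_const.mul h).neg.cexp)

/-- **(8.11) ⇒ (8.12) holds** (the node `Ded812 c′`): the two right sides are EQUAL, by the tree's
`Zhang2022.S811_eq_S812` (the change of variables, kernel-checked for all profiles continuous on
`(0,∞)` and all scales). [cite: Zhang2022LandauSiegel, §8 (8.11)–(8.12) p.48, tex L2472] -/
theorem ded812_holds : Ded812 c' := fun h811 ε hε =>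
  (h811 ε hε).mono fun D _ χ _ _ h hA j hj => by
    have key := h hA j hj
    rwa [S811_eq_S812 (continuousOn_frakfW c' D j 6) (continuousOn_frakfW c' D j 7)
      (continuousOn_frakgW c' D j 6) (continuousOn_frakgW c' D j 7)] at key

/-- `Ded812` — `_holds` alias of `ded812_holds` above under the fact's exact name (appended
2026-08-28, D-0026 bookkeeping: the proof term is the existing theorem of this file; no statement,
definition or attribute is edited; no new named fact; the ledger's debt table listed the fact
unproved). [cite: Zhang2022LandauSiegel, §8 (8.11)–(8.12) p.48, tex L2472] -/
theorem _root_.Literature.NumberTheory.LFunctions.Zhang2022.Section8cStatements.Ded812_holds :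
    Ded812 c' :=
  _root_.Literature.NumberTheory.LFunctions.Zhang2022.Section8cStatements.ded812_holds (c' := c')

end Literature.NumberTheory.LFunctions.Zhang2022.Section8cStatements
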